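import Literature.AnabelianGeometry.SemiGraphs.AmbientCategory
import Literature.AnabelianGeometry.SemiGraphs.InducedAlongInheritance
import Literature.AnabelianGeometry.SemiGraphs.LocalizationCompLaws

/-!
# Localizations `𝒢[v]`, `𝒢[e]`, `𝒢[b]` as objects and arrows of the ambient category `SgA` ([SemiAnbd] §4 Def 4.1) — merge step M4 part 5

Mochizuki, *Semi-graphs of anabelioids*, Publ. RIMS **42** (2006), §1 p.13, §4 Def 4.1 p.50,
Def 4.1 (iv) p.51 (kurims `paper:url-f33ace170ff4`). [cite: MochizukiSemiAnbd2006, Def 4.1, p. 50]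

CONSTRUCTION ONLY (L3 bridge toward `SemiAnbdVocab.ofReal`): the container `SemiAnbdVocab`
(`InterfaceVocab.lean`) is parametrised by the ambient category of totally aloof, verticially slim
semi-graphs of anabelioids and locally open arrows up to 2-isomorphism — `SgAQuot.SgA` of
`AmbientCategory.lean`.  This file packages the localizations of Def 4.1 IN THAT CATEGORY:

* `SgA.ofSgA`, `SgA.homMk'` — object / arrow constructors (a totally aloof, verticially slim
  semi-graph of anabelioids every edge of which abuts to a vertex; a locally open arrow of
  `SgAQuot`), with the projections `hom_hom_*`;
* objects `X.atVertex v`, `X.atEdge e` and the TOTAL `X.atBranch? b` (`= 𝒢[b]` for a branch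
  abutting to a vertex — the only case print defines, §1 p.13 — and the harmless value `𝒢[e_b]`
  otherwise, the container datum `locB` being total), using `atVertex_isTotallyAloof` etc.
  (`InducedAlongInheritance.lean`, abc-iut-L3-t3 gen 4);
* arrows `ιV`, `ιE`, `ιB`, `βV`, `βE` and the laws `βV_ι`, `βE_ι` (`LocalizationLaws.lean`);
* the distinguished vertex / edge `centerV`, `centerE` of `𝒢[v]`, `𝒢[e]`;
* the induced arrows `locMapV`, `locMapE` of Def 4.1 (iv) on arrows of `SgA` (from
  `SgAQuot.Hom.atVertexMap`, `LocalizationDescent.lean`) with the laws `_ι`, `_id`, `_comp`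
  (`LocalizationCompLaws.lean`) in the presentation of the container (target vertex as a
  parameter `w` with `f v = w`).

Nothing printed is asserted.
-/

namespace Literature.AnabelianGeometry.SemiGraphs

open CategoryTheory Literature.AnabelianGeometry.Anabelioids

universe v₁ u₁ u

namespace SgAQuot

open SemiGraphOfAnabelioids

namespace SgA

/-! ### Objects and arrows of the ambient category -/

/-- The object of the ambient category `SgA` given by a totally aloof, verticially slim semi-graph
of anabelioids in which every edge abuts to a vertex. [cite: MochizukiSemiAnbd2006, Rmk 2.4.2, p. 26] -/
def ofSgA (𝒢 : SemiGraphOfAnabelioids.{v₁, u₁, u}) (h₁ : 𝒢.IsTotallyAloof)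
    (h₂ : 𝒢.IsVerticiallySlim) (h₃ : 𝒢.EveryEdgeAbuts) : SgA.{v₁, u₁, u} :=
  ⟨⟨SgAQuot.mk 𝒢⟩, h₁, h₂, h₃⟩

/-- The underlying semi-graph of anabelioids of `ofSgA 𝒢 …` is `𝒢`. [cite: MochizukiSemiAnbd2006, Rmk 2.4.2, p. 26] -/
@[simp] theorem ofSgA_toSgA (𝒢 : SemiGraphOfAnabelioids.{v₁, u₁, u}) (h₁ : 𝒢.IsTotallyAloof)
    (h₂ : 𝒢.IsVerticiallySlim) (h₃ : 𝒢.EveryEdgeAbuts) : (ofSgA 𝒢 h₁ h₂ h₃).toSgA = 𝒢 := rfl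

variable {X Y Z : SgA.{v₁, u₁, u}}

/-- An object of the ambient category is totally aloof. [cite: MochizukiSemiAnbd2006, Rmk 2.4.2, p. 26] -/
theorem isTotallyAloof (X : SgA.{v₁, u₁, u}) : X.toSgA.IsTotallyAloof := X.property.1

/-- An object of the ambient category is verticially slim. [cite: MochizukiSemiAnbd2006, Rmk 2.4.2, p. 26] -/
theorem isVerticiallySlim (X : SgA.{v₁, u₁, u}) : X.toSgA.IsVerticiallySlim := X.property.2.1

/-- In an object of the ambient category every edge abuts to a vertex ([IUTchI] Rmk 2.5.3 (iii)).
[cite: MochizukiSemiAnbd2006, Rmk 2.4.2, p. 26] -/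
theorem everyEdgeAbuts (X : SgA.{v₁, u₁, u}) : X.toSgA.EveryEdgeAbuts := X.property.2.2

/-- The arrow of the ambient category given by a locally open arrow of `SgAQuot` between the
underlying objects. [cite: MochizukiSemiAnbd2006, Rmk 2.4.2, p. 26] -/
noncomputable def homMk' (a : X.obj.obj ⟶ Y.obj.obj) (ha : locallyOpen a) : X ⟶ Y :=
  ObjectProperty.homMk (InducedWideCategory.Hom.mk a ha)

/-- The underlying `SgAQuot`-arrow of `homMk' a _` is `a`. [cite: MochizukiSemiAnbd2006, Rmk 2.4.2, p. 26] -/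
@[simp] theorem homMk'_hom_hom (a : X.obj.obj ⟶ Y.obj.obj) (ha : locallyOpen a) :
    (homMk' a ha).hom.hom = a := rfl

/-- Arrows of the ambient category are determined by their underlying `SgAQuot`-arrows.
[cite: MochizukiSemiAnbd2006, Rmk 2.4.2, p. 26] -/
theorem hom_ext' {F G : X ⟶ Y} (h : F.hom.hom = G.hom.hom) : F = G :=
  ObjectProperty.hom_ext _ (WideSubcategory.hom_ext _ h)

/-- Underlying arrow of a composite. [cite: MochizukiSemiAnbd2006, Rmk 2.4.2, p. 26] -/
@[simp] theorem comp_hom_hom (F : X ⟶ Y) (G : Y ⟶ Z) : (F ≫ G).hom.hom = F.hom.hom ≫ G.hom.hom := rfl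

/-- Underlying arrow of an identity. [cite: MochizukiSemiAnbd2006, Rmk 2.4.2, p. 26] -/
@[simp] theorem id_hom_hom (X : SgA.{v₁, u₁, u}) : (𝟙 X : X ⟶ X).hom.hom = 𝟙 X.obj.obj := rfl

/-- Underlying arrow of a transport `eqToHom`. [cite: MochizukiSemiAnbd2006, Rmk 2.4.2, p. 26] -/
theorem eqToHom_hom_hom (h : X = Y) : (eqToHom h : X ⟶ Y).hom.hom = eqToHom (by rw [h]) := by
  subst h; rfl

/-- Arrows of the ambient category are locally open. [cite: MochizukiSemiAnbd2006, Rmk 2.4.2, p. 26] -/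
theorem locallyOpen_hom (F : X ⟶ Y) : locallyOpen F.hom.hom := F.hom.property

/-- The arrow of the ambient category defined by a locally open 1-morphism between the underlying
semi-graphs of anabelioids of two objects. [cite: MochizukiSemiAnbd2006, Rmk 2.4.2, p. 26] -/
noncomputable def homOfHom (φ : SemiGraphOfAnabelioids.Hom X.toSgA Y.toSgA) (hφ : φ.IsLocallyOpen) :
    X ⟶ Y :=
  homMk' (SgAQuot.homOf φ) ((homMk_mem_locallyOpen_iff φ.over).mpr hφ)

/-- Underlying arrow of `homOfHom`. [cite: MochizukiSemiAnbd2006, Rmk 2.4.2, p. 26] -/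
@[simp] theorem homOfHom_hom_hom (φ : SemiGraphOfAnabelioids.Hom X.toSgA Y.toSgA)
    (hφ : φ.IsLocallyOpen) : (homOfHom φ hφ).hom.hom = SgAQuot.homOf φ := rfl

/-! ### The localizations as objects of the ambient category -/

/-- `𝒢[v]` as an object of the ambient category (totally aloof, verticially slim, every edge
abutting to the vertex). [cite: MochizukiSemiAnbd2006, Def 4.1, p. 50] -/
noncomputable def atVertex (X : SgA.{v₁, u₁, u}) (v : X.toSgA.graph.Vertex) : SgA.{v₁, u₁, u} :=
  ofSgA (X.toSgA.atVertex v) (X.toSgA.atVertex_isTotallyAloof X.isTotallyAloof v)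
    (X.toSgA.atVertex_isVerticiallySlim X.isVerticiallySlim v) (X.toSgA.atVertex_everyEdgeAbuts v)

/-- `𝒢[e]` as an object of the ambient category. [cite: MochizukiSemiAnbd2006, Def 4.1, p. 50] -/
noncomputable def atEdge (X : SgA.{v₁, u₁, u}) (e : X.toSgA.graph.Edge) : SgA.{v₁, u₁, u} :=
  ofSgA (X.toSgA.atEdge e) (X.toSgA.atEdge_isTotallyAloof X.isTotallyAloof e)
    (X.toSgA.atEdge_isVerticiallySlim X.isVerticiallySlim e)
    (X.toSgA.atEdge_everyEdgeAbuts X.everyEdgeAbuts e)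

/-- `𝒢[b]` as an object of the ambient category, for a branch abutting to a vertex (the case print
defines, §1 p.13). [cite: MochizukiSemiAnbd2006, Def 4.1, p. 50] -/
noncomputable def atBranch (X : SgA.{v₁, u₁, u}) (b : X.toSgA.graph.Branch)
    (hb : (X.toSgA.graph.abuts b).isSome) : SgA.{v₁, u₁, u} :=
  ofSgA (X.toSgA.atBranch b hb) (X.toSgA.atBranch_isTotallyAloof X.isTotallyAloof b hb)
    (X.toSgA.atBranch_isVerticiallySlim X.isVerticiallySlim b hb)
    (X.toSgA.atBranch_everyEdgeAbuts b hb)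

/-- TOTAL version of `𝒢[b]` (the container datum `locB` of `InterfaceVocab.lean` is indexed by all
branches): `𝒢[b]` if `b` abuts to a vertex, and the harmless value `𝒢[e_b]` otherwise.
[cite: MochizukiSemiAnbd2006, Def 4.1, p. 50] -/
noncomputable def atBranch? (X : SgA.{v₁, u₁, u}) (b : X.toSgA.graph.Branch) : SgA.{v₁, u₁, u} :=
  if hb : (X.toSgA.graph.abuts b).isSome then X.atBranch b hb else X.atEdge (X.toSgA.graph.edgeOf b)

/-- For a branch abutting to a vertex the total localization is `𝒢[b]`.
[cite: MochizukiSemiAnbd2006, Def 4.1, p. 50] -/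
theorem atBranch?_eq (X : SgA.{v₁, u₁, u}) (b : X.toSgA.graph.Branch)
    (hb : (X.toSgA.graph.abuts b).isSome) : X.atBranch? b = X.atBranch b hb :=
  dif_pos hb

/-- For a branch abutting to no vertex the total localization is `𝒢[e_b]`.
[cite: MochizukiSemiAnbd2006, Def 4.1, p. 50] -/
theorem atBranch?_eq_atEdge (X : SgA.{v₁, u₁, u}) (b : X.toSgA.graph.Branch)
    (hb : ¬ (X.toSgA.graph.abuts b).isSome) : X.atBranch? b = X.atEdge (X.toSgA.graph.edgeOf b) :=
  dif_neg hb

/-! ### The natural arrows `𝒢[v] → 𝒢`, `𝒢[e] → 𝒢`, `𝒢[b] → 𝒢`, `𝒢[b] → 𝒢[v]`, `𝒢[b] → 𝒢[e]` -/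

/-- `𝒢[v] → 𝒢` in the ambient category. [cite: MochizukiSemiAnbd2006, Def 4.1, p. 50] -/
noncomputable def ιV (X : SgA.{v₁, u₁, u}) (v : X.toSgA.graph.Vertex) : X.atVertex v ⟶ X :=
  homOfHom (X := X.atVertex v) (X.toSgA.atVertexHom v) (X.toSgA.atVertexHom_isLocallyOpen v)

/-- `𝒢[e] → 𝒢` in the ambient category. [cite: MochizukiSemiAnbd2006, Def 4.1, p. 50] -/
noncomputable def ιE (X : SgA.{v₁, u₁, u}) (e : X.toSgA.graph.Edge) : X.atEdge e ⟶ X :=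
  homOfHom (X := X.atEdge e) (X.toSgA.atEdgeHom e) (X.toSgA.atEdgeHom_isLocallyOpen e)

/-- `𝒢[b] → 𝒢` in the ambient category, for a branch abutting to a vertex.
[cite: MochizukiSemiAnbd2006, Def 4.1, p. 50] -/
noncomputable def ιBr (X : SgA.{v₁, u₁, u}) (b : X.toSgA.graph.Branch)
    (hb : (X.toSgA.graph.abuts b).isSome) : X.atBranch b hb ⟶ X :=
  homOfHom (X := X.atBranch b hb) (X.toSgA.atBranchHom b hb) (X.toSgA.atBranchHom_isLocallyOpen b hb)

/-- `𝒢[b] → 𝒢[v]` over `𝒢` in the ambient category, for a branch abutting to `v = ζ(b)`.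
[cite: MochizukiSemiAnbd2006, Def 4.1, p. 50] -/
noncomputable def βVr (X : SgA.{v₁, u₁, u}) (b : X.toSgA.graph.Branch)
    (hb : (X.toSgA.graph.abuts b).isSome) :
    X.atBranch b hb ⟶ X.atVertex ((X.toSgA.graph.abuts b).get hb) :=
  homOfHom (X := X.atBranch b hb) (Y := X.atVertex ((X.toSgA.graph.abuts b).get hb))
    (X.toSgA.atBranchToAtVertex b hb) (X.toSgA.atBranchToAtVertex_isLocallyOpen b hb)

/-- `𝒢[b] → 𝒢[e]` over `𝒢` in the ambient category, for a branch abutting to a vertex.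
[cite: MochizukiSemiAnbd2006, Def 4.1, p. 50] -/
noncomputable def βEr (X : SgA.{v₁, u₁, u}) (b : X.toSgA.graph.Branch)
    (hb : (X.toSgA.graph.abuts b).isSome) :
    X.atBranch b hb ⟶ X.atEdge (X.toSgA.graph.edgeOf b) :=
  homOfHom (X := X.atBranch b hb) (Y := X.atEdge (X.toSgA.graph.edgeOf b))
    (X.toSgA.atBranchToAtEdge b hb) (X.toSgA.atBranchToAtEdge_isLocallyOpen b hb)

/-- **Law `βV_ι`** for `𝒢[b]`: `(𝒢[b] → 𝒢[v]) ≫ (𝒢[v] → 𝒢) = (𝒢[b] → 𝒢)` (§1 p.13 "over `G`").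
[cite: MochizukiSemiAnbd2006, Def 4.1, p. 50] -/
theorem βVr_ιV (X : SgA.{v₁, u₁, u}) (b : X.toSgA.graph.Branch)
    (hb : (X.toSgA.graph.abuts b).isSome) :
    X.βVr b hb ≫ X.ιV ((X.toSgA.graph.abuts b).get hb) = X.ιBr b hb :=
  hom_ext' (X.toSgA.homMk_atBranchToAtVertex_comp b hb)

/-- **Law `βE_ι`** for `𝒢[b]`: `(𝒢[b] → 𝒢[e]) ≫ (𝒢[e] → 𝒢) = (𝒢[b] → 𝒢)`.
[cite: MochizukiSemiAnbd2006, Def 4.1, p. 50] -/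
theorem βEr_ιE (X : SgA.{v₁, u₁, u}) (b : X.toSgA.graph.Branch)
    (hb : (X.toSgA.graph.abuts b).isSome) :
    X.βEr b hb ≫ X.ιE (X.toSgA.graph.edgeOf b) = X.ιBr b hb :=
  hom_ext' (X.toSgA.homMk_atBranchToAtEdge_comp b hb)

/-- A branch abutting to a vertex has `ζ(b) ≠ 𝒱`. [cite: MochizukiSemiAnbd2006, §1, p. 11] -/
theorem isSome_of_abuts_eq {X : SgA.{v₁, u₁, u}} {b : X.toSgA.graph.Branch}
    {v : X.toSgA.graph.Vertex} (h : X.toSgA.graph.abuts b = some v) :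
    (X.toSgA.graph.abuts b).isSome := by
  rw [h]; rfl

/-- The vertex a branch abuts to. [cite: MochizukiSemiAnbd2006, §1, p. 11] -/
theorem get_eq_of_abuts_eq {X : SgA.{v₁, u₁, u}} {b : X.toSgA.graph.Branch}
    {v : X.toSgA.graph.Vertex} (h : X.toSgA.graph.abuts b = some v) :
    (X.toSgA.graph.abuts b).get (isSome_of_abuts_eq h) = v := by
  simp only [h, Option.get_some]

/-- `𝒢[b] → 𝒢` on the total localization (`𝒢[e_b] → 𝒢` in the degenerate case).
[cite: MochizukiSemiAnbd2006, Def 4.1, p. 50] -/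
noncomputable def ιB (X : SgA.{v₁, u₁, u}) (b : X.toSgA.graph.Branch) : X.atBranch? b ⟶ X :=
  if hb : (X.toSgA.graph.abuts b).isSome then eqToHom (X.atBranch?_eq b hb) ≫ X.ιBr b hb
  else eqToHom (X.atBranch?_eq_atEdge b hb) ≫ X.ιE (X.toSgA.graph.edgeOf b)

/-- `𝒢[b] → 𝒢[v]` on the total localization, for `b` abutting to `v`.
[cite: MochizukiSemiAnbd2006, Def 4.1, p. 50] -/
noncomputable def βV (X : SgA.{v₁, u₁, u}) (b : X.toSgA.graph.Branch) (v : X.toSgA.graph.Vertex)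
    (h : X.toSgA.graph.abuts b = some v) : X.atBranch? b ⟶ X.atVertex v :=
  eqToHom (X.atBranch?_eq b (isSome_of_abuts_eq h)) ≫ X.βVr b (isSome_of_abuts_eq h) ≫
    eqToHom (by rw [get_eq_of_abuts_eq h])

/-- `𝒢[b] → 𝒢[e]` on the total localization (the identity of `𝒢[e_b]` in the degenerate case).
[cite: MochizukiSemiAnbd2006, Def 4.1, p. 50] -/
noncomputable def βE (X : SgA.{v₁, u₁, u}) (b : X.toSgA.graph.Branch) :
    X.atBranch? b ⟶ X.atEdge (X.toSgA.graph.edgeOf b) :=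
  if hb : (X.toSgA.graph.abuts b).isSome then eqToHom (X.atBranch?_eq b hb) ≫ X.βEr b hb
  else eqToHom (X.atBranch?_eq_atEdge b hb)

/-- **Law `βV_ι`** (container form): `(𝒢[b] → 𝒢[v]) ≫ (𝒢[v] → 𝒢) = (𝒢[b] → 𝒢)`.
[cite: MochizukiSemiAnbd2006, Def 4.1, p. 50] -/
theorem βV_ι (X : SgA.{v₁, u₁, u}) (b : X.toSgA.graph.Branch) (v : X.toSgA.graph.Vertex)
    (h : X.toSgA.graph.abuts b = some v) : X.βV b v h ≫ X.ιV v = X.ιB b := by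
  have hb : (X.toSgA.graph.abuts b).isSome := isSome_of_abuts_eq h
  have hv : (X.toSgA.graph.abuts b).get hb = v := get_eq_of_abuts_eq h
  subst hv
  simp only [βV, ιB, dif_pos hb, eqToHom_refl, Category.comp_id, Category.assoc, βVr_ιV]

/-- **Law `βE_ι`** (container form): `(𝒢[b] → 𝒢[e]) ≫ (𝒢[e] → 𝒢) = (𝒢[b] → 𝒢)`.
[cite: MochizukiSemiAnbd2006, Def 4.1, p. 50] -/
theorem βE_ι (X : SgA.{v₁, u₁, u}) (b : X.toSgA.graph.Branch) :
    X.βE b ≫ X.ιE (X.toSgA.graph.edgeOf b) = X.ιB b := by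
  by_cases hb : (X.toSgA.graph.abuts b).isSome
  · simp only [βE, ιB, dif_pos hb, Category.assoc, βEr_ιE]
  · simp only [βE, ιB, dif_neg hb]

/-! ### The distinguished vertex of `𝒢[v]` and edge of `𝒢[e]` -/

/-- "`G[v]` consists of a single vertex `v'`, which maps to `v`" (§1 p.13): that vertex.
[cite: MochizukiSemiAnbd2006, §1, p. 13] -/
def centerV (X : SgA.{v₁, u₁, u}) (v : X.toSgA.graph.Vertex) : (X.atVertex v).toSgA.graph.Vertex :=
  PUnit.unit

/-- The distinguished vertex of `𝒢[v]` maps to `v`. [cite: MochizukiSemiAnbd2006, §1, p. 13] -/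
theorem ιV_vertexMap_centerV (X : SgA.{v₁, u₁, u}) (v : X.toSgA.graph.Vertex) :
    (X.ιV v).hom.hom.base.vertexMap (X.centerV v) = v := rfl

/-- "`G[e]` consists of a single edge `e'`, which maps to `e`" (§1 p.13): that edge.
[cite: MochizukiSemiAnbd2006, §1, p. 13] -/
def centerE (X : SgA.{v₁, u₁, u}) (e : X.toSgA.graph.Edge) : (X.atEdge e).toSgA.graph.Edge :=
  PUnit.unit

/-- The distinguished edge of `𝒢[e]` maps to `e`. [cite: MochizukiSemiAnbd2006, §1, p. 13] -/
theorem ιE_edgeMap_centerE (X : SgA.{v₁, u₁, u}) (e : X.toSgA.graph.Edge) :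
    (X.ιE e).hom.hom.base.edgeMap (X.centerE e) = e := rfl

/-! ### Def 4.1 (iv): the induced arrows `𝒢[v] → ℋ[f v]`, `𝒢[e] → ℋ[f e]` on arrows of `SgA` -/

/-- The induced `SgAQuot`-arrow `X[v] → Y[F v]` of a locally open arrow is locally open.
[cite: MochizukiSemiAnbd2006, Def 4.1 (iv), p. 51] -/
theorem _root_.Literature.AnabelianGeometry.SemiGraphs.SgAQuot.locallyOpen_atVertexMap
    {X Y : SgAQuot.{v₁, u₁, u}} (F : X ⟶ Y) (hF : locallyOpen F) (v : X.toSgA.graph.Vertex) :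
    locallyOpen (Hom.atVertexMap F v) := by
  obtain ⟨f, a⟩ := F
  induction a using Quotient.ind with
  | _ φ =>
    change locallyOpen (SgAQuot.homOf (φ.atVertexMap v))
    exact (homMk_mem_locallyOpen_iff (φ.atVertexMap v).over).mpr
      (φ.atVertexMap_isLocallyOpen ((homMk_mem_locallyOpen_iff φ).mp hF) v)

/-- The induced `SgAQuot`-arrow `X[e] → Y[F e]` of a locally open arrow is locally open.
[cite: MochizukiSemiAnbd2006, Def 4.1 (iv), p. 51] -/
theorem _root_.Literature.AnabelianGeometry.SemiGraphs.SgAQuot.locallyOpen_atEdgeMap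
    {X Y : SgAQuot.{v₁, u₁, u}} (F : X ⟶ Y) (hF : locallyOpen F) (e : X.toSgA.graph.Edge) :
    locallyOpen (Hom.atEdgeMap F e) := by
  obtain ⟨f, a⟩ := F
  induction a using Quotient.ind with
  | _ φ =>
    change locallyOpen (SgAQuot.homOf (φ.atEdgeMap e))
    exact (homMk_mem_locallyOpen_iff (φ.atEdgeMap e).over).mpr
      (φ.atEdgeMap_isLocallyOpen ((homMk_mem_locallyOpen_iff φ).mp hF) e)

/-- The induced arrow `X[v] → Y[F v]` of an arrow of `SgA` is locally open.
[cite: MochizukiSemiAnbd2006, Def 4.1 (iv), p. 51] -/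
theorem locallyOpen_atVertexMap (F : X ⟶ Y) (v : X.toSgA.graph.Vertex) :
    locallyOpen (Hom.atVertexMap F.hom.hom v) :=
  SgAQuot.locallyOpen_atVertexMap F.hom.hom (locallyOpen_hom F) v

/-- The induced arrow `X[e] → Y[F e]` of an arrow of `SgA` is locally open.
[cite: MochizukiSemiAnbd2006, Def 4.1 (iv), p. 51] -/
theorem locallyOpen_atEdgeMap (F : X ⟶ Y) (e : X.toSgA.graph.Edge) :
    locallyOpen (Hom.atEdgeMap F.hom.hom e) :=
  SgAQuot.locallyOpen_atEdgeMap F.hom.hom (locallyOpen_hom F) e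

/-- **Def 4.1 (iv) in the ambient category**: the arrow `X[v] → Y[w]` induced by `F : X → Y` with
`F v = w` (container datum `locMapV`). [cite: MochizukiSemiAnbd2006, Def 4.1 (iv), p. 51] -/
noncomputable def locMapV (F : X ⟶ Y) (v : X.toSgA.graph.Vertex) (w : Y.toSgA.graph.Vertex)
    (h : F.hom.hom.base.vertexMap v = w) : X.atVertex v ⟶ Y.atVertex w :=
  homMk' (X := X.atVertex v) (Y := Y.atVertex (F.hom.hom.base.vertexMap v))
      (Hom.atVertexMap F.hom.hom v) (locallyOpen_atVertexMap F v) ≫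
    eqToHom (by rw [h])

/-- **Def 4.1 (iv) in the ambient category**: the arrow `X[e] → Y[e']` induced by `F : X → Y`
with `F e = e'` (container datum `locMapE`). [cite: MochizukiSemiAnbd2006, Def 4.1 (iv), p. 51] -/
noncomputable def locMapE (F : X ⟶ Y) (e : X.toSgA.graph.Edge) (e' : Y.toSgA.graph.Edge)
    (h : F.hom.hom.base.edgeMap e = e') : X.atEdge e ⟶ Y.atEdge e' :=
  homMk' (X := X.atEdge e) (Y := Y.atEdge (F.hom.hom.base.edgeMap e))
      (Hom.atEdgeMap F.hom.hom e) (locallyOpen_atEdgeMap F e) ≫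
    eqToHom (by rw [h])

/-- **Law `locMapV_ι`**: the induced `X[v] → Y[w]` lies over `F`.
[cite: MochizukiSemiAnbd2006, Def 4.1 (iv), p. 51] -/
theorem locMapV_ι (F : X ⟶ Y) (v : X.toSgA.graph.Vertex) (w : Y.toSgA.graph.Vertex)
    (h : F.hom.hom.base.vertexMap v = w) : locMapV F v w h ≫ Y.ιV w = X.ιV v ≫ F := by
  subst h
  apply hom_ext'
  simp only [locMapV, eqToHom_refl, Category.comp_id, comp_hom_hom, homMk'_hom_hom]
  exact Hom.atVertexMap_comp_atVertexHom F.hom.hom v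

/-- **Law `locMapE_ι`**: the induced `X[e] → Y[e']` lies over `F`.
[cite: MochizukiSemiAnbd2006, Def 4.1 (iv), p. 51] -/
theorem locMapE_ι (F : X ⟶ Y) (e : X.toSgA.graph.Edge) (e' : Y.toSgA.graph.Edge)
    (h : F.hom.hom.base.edgeMap e = e') :
    locMapE F e e' h ≫ Y.ιE e' = X.ιE e ≫ F := by
  subst h
  apply hom_ext'
  simp only [locMapE, eqToHom_refl, Category.comp_id, comp_hom_hom, homMk'_hom_hom]
  exact Hom.atEdgeMap_comp_atEdgeHom F.hom.hom e

/-- **Law `locMapV_id`**: the identity induces the identity `X[v] → X[v]`.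
[cite: MochizukiSemiAnbd2006, Def 4.1 (iv), p. 51] -/
theorem locMapV_id (X : SgA.{v₁, u₁, u}) (v : X.toSgA.graph.Vertex)
    (h : (𝟙 X : X ⟶ X).hom.hom.base.vertexMap v = v) :
    locMapV (𝟙 X) v v h = 𝟙 (X.atVertex v) := by
  apply hom_ext'
  simp only [locMapV, comp_hom_hom, homMk'_hom_hom, id_hom_hom]
  erw [Hom.atVertexMap_id, eqToHom_refl, Category.comp_id]
  rfl

/-- **Law `locMapE_id`**: the identity induces the identity `X[e] → X[e]`.
[cite: MochizukiSemiAnbd2006, Def 4.1 (iv), p. 51] -/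
theorem locMapE_id (X : SgA.{v₁, u₁, u}) (e : X.toSgA.graph.Edge)
    (h : (𝟙 X : X ⟶ X).hom.hom.base.edgeMap e = e) :
    locMapE (𝟙 X) e e h = 𝟙 (X.atEdge e) := by
  apply hom_ext'
  simp only [locMapE, comp_hom_hom, homMk'_hom_hom, id_hom_hom]
  erw [Hom.atEdgeMap_id, eqToHom_refl, Category.comp_id]
  rfl

/-- **Law `locMapV_comp`**: localization at vertices preserves composites.
[cite: MochizukiSemiAnbd2006, Def 4.1 (iv), p. 51] -/
theorem locMapV_comp (F : X ⟶ Y) (G : Y ⟶ Z) (v : X.toSgA.graph.Vertex)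
    (w : Y.toSgA.graph.Vertex) (x : Z.toSgA.graph.Vertex) (h₁ : F.hom.hom.base.vertexMap v = w)
    (h₂ : G.hom.hom.base.vertexMap w = x) (h₃ : (F ≫ G).hom.hom.base.vertexMap v = x) :
    locMapV (F ≫ G) v x h₃ = locMapV F v w h₁ ≫ locMapV G w x h₂ := by
  subst h₁; subst h₂
  apply hom_ext'
  simp only [locMapV, comp_hom_hom, homMk'_hom_hom, eqToHom_refl, Category.comp_id]
  erw [eqToHom_refl, Category.comp_id]
  exact Hom.atVertexMap_comp F.hom.hom G.hom.hom v

/-- **Law `locMapE_comp`**: localization at edges preserves composites.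
[cite: MochizukiSemiAnbd2006, Def 4.1 (iv), p. 51] -/
theorem locMapE_comp (F : X ⟶ Y) (G : Y ⟶ Z) (e : X.toSgA.graph.Edge)
    (e' : Y.toSgA.graph.Edge) (e'' : Z.toSgA.graph.Edge) (h₁ : F.hom.hom.base.edgeMap e = e')
    (h₂ : G.hom.hom.base.edgeMap e' = e'') (h₃ : (F ≫ G).hom.hom.base.edgeMap e = e'') :
    locMapE (F ≫ G) e e'' h₃ = locMapE F e e' h₁ ≫ locMapE G e' e'' h₂ := by
  subst h₁; subst h₂
  apply hom_ext'
  simp only [locMapE, comp_hom_hom, homMk'_hom_hom, eqToHom_refl, Category.comp_id]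
  erw [eqToHom_refl, Category.comp_id]
  exact Hom.atEdgeMap_comp F.hom.hom G.hom.hom e

end SgA

end SgAQuot

end Literature.AnabelianGeometry.SemiGraphs
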